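import Literature.GroupTheory.CombinatorialGroupTheory.ConjugacySeparable
import Mathlib.GroupTheory.Index
import Mathlib.GroupTheory.QuotientGroup.Basic
import Mathlib.GroupTheory.Coset.Basic
import Mathlib.Algebra.Group.Conj
import HarnessLib

/-!
# Lifting conjugacy separability from a normal subgroup of finite index

Topic `Literature/GroupTheory/CombinatorialGroupTheory`; theorems only, over the tree's predicate
`IsConjugacySeparable` (`ConjugacySeparable.lean`: P. F. Stebe, Trans. AMS 163 (1972), p. 173).

**Lemma (the standard reduction to a finite-index subgroup).**  Let `K ⊴ G` be a normal subgroup of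
finite index which is conjugacy separable, and let `a, b ∈ G` have powers `aᵏ, bᵏ ∈ K` that are NOT
conjugate in `G`.  Then some finite quotient of `G` separates the conjugacy classes of `a` and `b`
(`exists_normal_finiteIndex_not_isConj_of_pow_mem`).

*Proof.*  The `G`-conjugacy class of `aᵏ` inside `K` is the union of the `K`-conjugacy classes of the
finitely many elements `t aᵏ t⁻¹`, `t` running over a transversal of `K` in `G`; none of them is
`K`-conjugate to `bᵏ`.  Conjugacy separability of `K` gives normal finite-index `M_t ⊴ K` separating
`t aᵏ t⁻¹` from `bᵏ`; the normal core `L` in `G` of `⋂ M_t` is a normal subgroup of finite index of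
`G`, and a conjugator `ḡ` of `ā` into `b̄` in `G ⧸ L`, written `g = κ t` (`κ ∈ K`), would conjugate
the image of `t aᵏ t⁻¹` into that of `bᵏ` inside `K ⧸ M_t` — contradiction.  This is the reduction by
which conjugacy separability of virtually free groups is obtained from that of free groups for
elements of infinite order (J. L. Dyer, *Separating conjugates in free-by-finite groups*, J. London
Math. Soc. (2) 20 (1979) 215–221, §2; P. F. Stebe, *A residual property of certain groups*, Proc. AMS
26 (1970) 37–42, proof of Thm. 2), and the form in which it enters the conjugacy separability of
cyclic amalgams of free groups and of surface groups (J. L. Dyer, J. Austral. Math. Soc. A 29 (1980)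
35–51, Thm. 10; Stebe 1972, Thm. 3.3) after passage to a compatible finite amalgam.

* `exists_normal_finiteIndex_not_isConj_of_pow_mem` — the lemma;
* `isConjugacySeparable_of_finiteIndex_of_isConj_pow` — corollary: a group in which conjugacy of
  `k`-th powers (`k ≥ 1`) implies conjugacy, having a conjugacy separable normal subgroup of finite
  index, is conjugacy separable;
* private bookkeeping: conjugacy of images passes to larger normal subgroups; conjugate images
  have conjugate powers; a conjugator in a quotient lifts.

Deliberately NOT here: which groups have the unique-root property (free groups, surface groups), the
virtually free case itself (needs a free normal subgroup of finite index), `p`-versions.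
-/

namespace Literature.GroupTheory.CombinatorialGroupTheory

universe u

variable {G : Type u} [Group G]

/-- Conjugacy of images in `G ⧸ L` passes to `G ⧸ L'` for `L ≤ L'`. [folklore] -/
private theorem isConj_mk_of_le' {L L' : Subgroup G} [L.Normal] [L'.Normal] (h : L ≤ L') {a b : G}
    (hc : IsConj (QuotientGroup.mk a : G ⧸ L) (QuotientGroup.mk b)) :
    IsConj (QuotientGroup.mk a : G ⧸ L') (QuotientGroup.mk b) := by
  have := (QuotientGroup.map L L' (MonoidHom.id G) fun x hx => h hx).map_isConj hc
  simpa only [QuotientGroup.map_mk, MonoidHom.id_apply] using this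

/-- Conjugate images have conjugate powers: `ā ~ b̄` in `G ⧸ L` gives `aᵏ L ~ bᵏ L`. [folklore] -/
private theorem isConj_pow_mk {L : Subgroup G} [L.Normal] {a b : G} (k : ℕ)
    (hc : IsConj (QuotientGroup.mk a : G ⧸ L) (QuotientGroup.mk b)) :
    IsConj (QuotientGroup.mk (a ^ k) : G ⧸ L) (QuotientGroup.mk (b ^ k)) := by
  obtain ⟨c, hc⟩ := hc
  refine ⟨c, ?_⟩
  rw [QuotientGroup.mk_pow, QuotientGroup.mk_pow]
  exact hc.pow_right k

/-- A conjugator in a quotient lifts: from `ā ~ b̄` in `G ⧸ L`, some `g ∈ G` has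
`(g a g⁻¹)⁻¹ b ∈ L`. [folklore] -/
private theorem exists_conj_inv_mul_mem_of_isConj_mk {L : Subgroup G} [L.Normal] {a b : G}
    (hc : IsConj (QuotientGroup.mk a : G ⧸ L) (QuotientGroup.mk b)) :
    ∃ g : G, (g * a * g⁻¹)⁻¹ * b ∈ L := by
  obtain ⟨c, hc⟩ := isConj_iff.mp hc
  obtain ⟨g, rfl⟩ := QuotientGroup.mk_surjective c
  refine ⟨g, ?_⟩
  rw [← QuotientGroup.eq]
  simpa only [QuotientGroup.mk_mul, QuotientGroup.mk_inv] using hc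

/-- **Lifting conjugacy separability from a finite-index normal subgroup.**  `K ⊴ G` normal of finite
index and conjugacy separable; `aᵏ, bᵏ ∈ K` not conjugate in `G`; then `a` and `b` have non-conjugate
images in some finite quotient `G ⧸ L` — the normal-core step that ends Lyndon–Schupp's proof of
I.4.8 (there for index `2`), for arbitrary finite index. [cite: LyndonSchupp2001, Ch. I Prop. 4.8 (proof, last step)] -/
theorem exists_normal_finiteIndex_not_isConj_of_pow_mem (K : Subgroup G) [K.Normal] [K.FiniteIndex]
    (hK : IsConjugacySeparable K) {a b : G} {k : ℕ} (ha : a ^ k ∈ K) (hb : b ^ k ∈ K)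
    (hab : ¬ IsConj (a ^ k) (b ^ k)) :
    ∃ (L : Subgroup G) (_ : L.Normal) (_ : L.FiniteIndex),
      ¬ IsConj (QuotientGroup.mk a : G ⧸ L) (QuotientGroup.mk b) := by
  classical
  haveI : Finite (G ⧸ K) := Subgroup.finite_quotient_of_finiteIndex
  -- a section of `G → G ⧸ K`
  let s : G ⧸ K → G := Quotient.out
  have hs : ∀ q : G ⧸ K, (QuotientGroup.mk (s q) : G ⧸ K) = q := fun q => Quotient.out_eq q
  -- the finitely many `K`-representatives `t aᵏ t⁻¹` of the `G`-class of `aᵏ`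
  have hu : ∀ q : G ⧸ K, s q * a ^ k * (s q)⁻¹ ∈ K := fun q => Subgroup.Normal.conj_mem ‹_› _ ha _
  let u : G ⧸ K → K := fun q => ⟨s q * a ^ k * (s q)⁻¹, hu q⟩
  let v : K := ⟨b ^ k, hb⟩
  have huv : ∀ q, ¬ IsConj (u q) v := by
    intro q h
    apply hab
    have h' : IsConj (s q * a ^ k * (s q)⁻¹) (b ^ k) := by
      simpa using K.subtype.map_isConj h
    exact (isConj_iff.mpr ⟨s q, rfl⟩).trans h'
  -- separate each pair in a finite quotient of `K`
  have hsep := fun q => isConjugacySeparable_iff_quotient.mp hK (u q) v (huv q)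
  choose M hMn hMf hMsep using hsep
  -- `M₀ = ⋂ M_q`, normal of finite index in `K`
  let M₀ : Subgroup K := ⨅ q, M q
  haveI hM₀n : M₀.Normal := Subgroup.normal_iInf_normal fun q => hMn q
  haveI hM₀f : M₀.FiniteIndex := by
    haveI := fun q => hMf q
    exact Subgroup.finiteIndex_iInf fun q => (hMf q)
  -- push to `G` and take the normal core
  let M₁ : Subgroup G := M₀.map K.subtype
  haveI hM₁f : M₁.FiniteIndex := by
    constructor
    rw [Subgroup.index_map_subtype]
    exact Nat.mul_ne_zero hM₀f.index_ne_zero (Subgroup.FiniteIndex.index_ne_zero)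
  let L : Subgroup G := M₁.normalCore
  refine ⟨L, inferInstance, inferInstance, fun hc => ?_⟩
  -- a conjugator `g` of `a` into `b` modulo `L`; then `g aᵏ g⁻¹ ≡ bᵏ`
  obtain ⟨g, hg⟩ := exists_conj_inv_mul_mem_of_isConj_mk (isConj_pow_mk k hc)
  -- write `g = κ · s q` with `κ ∈ K`
  let q : G ⧸ K := QuotientGroup.mk g
  have hκ : g * (s q)⁻¹ ∈ K := by
    rw [← QuotientGroup.eq_one_iff, QuotientGroup.mk_mul, QuotientGroup.mk_inv, hs q, mul_inv_cancel]
  let κ : K := ⟨g * (s q)⁻¹, hκ⟩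
  -- the element `(κ u_q κ⁻¹)⁻¹ v` of `K` lies in `M q`
  have hmem : ((κ * u q * κ⁻¹)⁻¹ * v : K) ∈ M q := by
    have h1 : (g * a ^ k * g⁻¹)⁻¹ * b ^ k ∈ M₁ := Subgroup.normalCore_le M₁ hg
    have h2 : (K.subtype ((κ * u q * κ⁻¹)⁻¹ * v)) = (g * a ^ k * g⁻¹)⁻¹ * b ^ k := by
      simp only [Subgroup.coe_subtype, Subgroup.coe_mul, Subgroup.coe_inv, u, v, κ]
      group
    have h3 : ((κ * u q * κ⁻¹)⁻¹ * v : K) ∈ M₀ := by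
      have : K.subtype ((κ * u q * κ⁻¹)⁻¹ * v) ∈ M₁ := by rw [h2]; exact h1
      rcases Subgroup.mem_map.mp this with ⟨y, hy, hyeq⟩
      have : y = (κ * u q * κ⁻¹)⁻¹ * v := K.subtype_injective hyeq
      rw [← this]; exact hy
    exact (Subgroup.mem_iInf.mp h3) q
  -- hence the images of `u q` and `v` are conjugate in `K ⧸ M q`: contradiction
  haveI := hMn q
  apply hMsep q
  refine isConj_iff.mpr ⟨QuotientGroup.mk κ, ?_⟩
  rw [← QuotientGroup.mk_mul, ← QuotientGroup.mk_inv, ← QuotientGroup.mk_mul, QuotientGroup.eq]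
  exact hmem

/-- **Corollary.**  If conjugacy of `k`-th powers (`k ≥ 1`) implies conjugacy in `G` (e.g. free groups,
orientable surface groups) and `G` has a conjugacy separable normal subgroup of finite index, then `G`
is conjugacy separable. [cite: LyndonSchupp2001, Ch. I Prop. 4.8 (proof, last step)] -/
theorem isConjugacySeparable_of_finiteIndex_of_isConj_pow (K : Subgroup G) [K.Normal] [K.FiniteIndex]
    (hK : IsConjugacySeparable K)
    (hroot : ∀ (a b : G) (k : ℕ), 0 < k → IsConj (a ^ k) (b ^ k) → IsConj a b) :
    IsConjugacySeparable G := by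
  refine isConjugacySeparable_iff_quotient.mpr fun a b hab => ?_
  have hk : 0 < K.index := Nat.pos_of_ne_zero Subgroup.FiniteIndex.index_ne_zero
  exact exists_normal_finiteIndex_not_isConj_of_pow_mem K hK (Subgroup.pow_index_mem K a)
    (Subgroup.pow_index_mem K b) fun h => hab (hroot a b K.index hk h)

end Literature.GroupTheory.CombinatorialGroupTheory
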